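import Summits.BirchSwinnertonDyer.BirchSwinnertonDyer.Theorems.CMKolyvaginAtInertTwoConjugationTypeAtTwo
import Literature.NumberTheory.EllipticCurves.PointDivisibilityProofs
import Literature.NumberTheory.EllipticCurves.HeegnerPointsKolyvaginPrimaryDescentProofs
import HarnessLib

/-!
# Route `CMKolyvaginAtInertTwo`, crux `CMKolyvaginExactAtInertTwo` (stmt-BirchSwinnertonDyer-24277):
# A REGULAR ELEMENT OF `E[2^M]` ON `Δ < 0` — the input `hm` of the Čebotarev binder `cebotarev_binder_pair`

Seat `bsd-line-cmk2-p1` g13 (cell `bsd-print-cf2`); helper (`--supports stmt-BirchSwinnertonDyer-24277`).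
THEOREMS ONLY: no definition, no named fact, no `sorry`; no item is closed; BSD is not proved by this.

The order-form Čebotarev binder at `2` (`KolyvaginPairDataTwo.cebotarev_binder_pair`) takes an element
`m₀ ∈ E[2^M]` with `k • (m₀ ± τ m₀) = 0 ⟹ 2^M ∣ k` (`τ` = the torsion map of the transported
complex conjugation): then `a ↦ a m₀ + ν a τm₀` is injective on `ℤ/2^M` for both signs and no bit
is lost in McCallum's (2)–(3) at `2` (the regular `ℤ/2^M[τ]`-module structure of `E[2^M]`, seat g10).
This file PRODUCES `m₀` for every `E/ℚ` with `Δ_E < 0` (the habitat: `E(ℝ)` connected, so complex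
conjugation MOVES a `2`-torsion point — g3's `KolyvaginEigenTwo.exists_twoTorsion_smul_ne_of_Δ_neg`):
take a `2`-torsion point `t` with `τ t ≠ t` and any `m₀` with `2^{M−1} m₀ = t` (`[2^{M−1}]` is onto
`E(K̄)`); then `2^{M−1}(m₀ ± τm₀) = t + τt ≠ 0`, so `m₀ ± τm₀` has order exactly `2^M`.

* `exists_regular_torsion_of_Δ_neg` — the statement above, in the binder's exact shape.

References: [SilvermanAEC2009] III.1 (real `2`-torsion), VIII.2 (`[m]` onto `E(K̄)`);
[McCallumLMS1991] §3 (2)–(3); [GrossLMS1991] §9.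
-/

-- single-conjunct summit: `Summit.BirchSwinnertonDyer.BirchSwinnertonDyer.…` repeats the name by design
set_option linter.dupNamespace false
set_option autoImplicit false

noncomputable section

open scoped Classical
open WeierstrassCurve NumberField Field
open Literature.NumberTheory.GaloisRepresentations
open Literature.NumberTheory.EllipticCurves Literature.NumberTheory.EllipticCurves.KolyvaginDescent

namespace Summit.BirchSwinnertonDyer.BirchSwinnertonDyer.Theorems.KolyvaginPairDataTwo

/-- **A regular element of `E[2^M]` on `Δ < 0`.** For `E/ℚ` with `Δ_E < 0`, `K` imaginary quadratic
with its conjugation `c ≠ 1`, a complex conjugation `c₀ ∈ Γ_ℚ` and `M ≥ 1`, there is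
`m₀ ∈ E(K̄)[2^M]` such that for both signs `s = ±1`, `k • (m₀ + s • τ m₀) = 0` forces `2^M ∣ k`
(`τ` = `IsLiftOfAut.torsionMap` of the transported conjugation): `m₀ ± τ m₀` have order exactly
`2^M`. Proof: a `2`-torsion point moved by `c₀` (real locus connected), divided by `2^{M−1}`.
[cite: SilvermanAEC2009, III.1, VIII.2 ([m] is onto E(K̄))] [cite: McCallumLMS1991, §3 (2), (3)] -/
theorem exists_regular_torsion_of_Δ_neg (W : WeierstrassCurve ℚ) [W.IsElliptic] {K : Type} [Field K]
    [NumberField K] (hK : IsImaginaryQuadratic K) (hΔ : W.Δ < 0) {c : K ≃ₐ[ℚ] K} (hc : c ≠ 1)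
    {c₀ : absoluteGaloisGroup ℚ} (hc₀ : IsComplexConjugation (Rat.castHom ℝ) c₀) {M : ℕ} (hM : 1 ≤ M) :
    ∃ m₀ : geomTorsion (W.baseChange K) ((2 ^ M : ℕ) : ℤ), ∀ s : ℤ, s = 1 ∨ s = -1 → ∀ k : ℤ,
      k • (m₀ + s • (RatClosure.isLiftOfAut_absGaloisTransport_of_isImaginaryQuadratic hK hc hc₀).torsionMap
        W ((2 ^ M : ℕ) : ℤ) m₀) = 0 → ((2 ^ M : ℕ) : ℤ) ∣ k := by
  have ht := RatClosure.isLiftOfAut_absGaloisTransport_of_isImaginaryQuadratic hK hc hc₀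
  -- ### a `2`-torsion point moved by the conjugation, transported to `E(K̄)`
  obtain ⟨v₀, hv₀⟩ := KolyvaginEigenTwo.exists_twoTorsion_smul_ne_of_Δ_neg W hΔ hc₀
  set θ := RatClosure.torsionEquiv (K := K) W ((2 : ℕ) : ℤ) with hθ
  have hv : ht.torsionMap W ((2 : ℕ) : ℤ) (θ v₀) ≠ θ v₀ := by
    rw [← RatClosure.torsionEquiv_smul_of_lift W ht c₀ (fun _ ↦ rfl) ((2 : ℕ) : ℤ) v₀]
    exact fun h ↦ hv₀ (θ.injective h)
  set t₁ : geomTorsion (W.baseChange K) ((2 : ℕ) : ℤ) := θ v₀ with ht₁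
  have ht₁2 : ((2 : ℕ) : ℤ) • (t₁ : geomPoints (W.baseChange K)) = 0 := (mem_geomTorsion_iff _ _ _).mp t₁.2
  -- ### `m₀` with `2^{M-1} m₀ = t₁`
  have hpow0 : (((2 : ℕ) : ℤ) ^ (M - 1)) ≠ 0 := pow_ne_zero _ (by norm_num)
  obtain ⟨R, hR⟩ := (W.baseChange K).zsmul_geomPoints_surjective_holds hpow0
    (t₁ : geomPoints (W.baseChange K))
  change (((2 : ℕ) : ℤ) ^ (M - 1)) • R = (t₁ : geomPoints (W.baseChange K)) at hR
  have h2pow : ((2 ^ M : ℕ) : ℤ) = ((2 : ℕ) : ℤ) * ((2 : ℕ) : ℤ) ^ (M - 1) := by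
    rw [← pow_succ', Nat.sub_add_cancel hM]
    push_cast
    ring
  have hRmem : R ∈ geomTorsion (W.baseChange K) ((2 ^ M : ℕ) : ℤ) := by
    rw [mem_geomTorsion_iff, h2pow, mul_zsmul, hR, ht₁2]
  set m₀ : geomTorsion (W.baseChange K) ((2 ^ M : ℕ) : ℤ) := ⟨R, hRmem⟩ with hm₀
  refine ⟨m₀, fun s hs k hk ↦ ?_⟩
  set y : geomTorsion (W.baseChange K) ((2 ^ M : ℕ) : ℤ) :=
    m₀ + s • ht.torsionMap W ((2 ^ M : ℕ) : ℤ) m₀ with hy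
  -- `2^M y = 0`
  have hyM : (((2 : ℕ) : ℤ) ^ M) • y = 0 := by
    apply Subtype.ext
    rw [AddSubgroupClass.coe_zsmul, ZeroMemClass.coe_zero, ← Nat.cast_pow]
    exact (mem_geomTorsion_iff _ _ _).mp y.2
  -- `2^{M-1} y ≠ 0`: its underlying point is `t₁ + s τ t₁ = t₁ + τ t₁ ≠ 0`
  have hτt : ((ht.torsionMap W ((2 : ℕ) : ℤ) t₁ : geomTorsion (W.baseChange K) ((2 : ℕ) : ℤ)) :
      geomPoints (W.baseChange K)) = ht.pointsMap W (t₁ : geomPoints (W.baseChange K)) :=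
    ht.coe_torsionMap W _ _
  have hybot : (((2 : ℕ) : ℤ) ^ (M - 1)) • y ≠ 0 := by
    intro h
    have h' := congrArg (fun P : geomTorsion (W.baseChange K) ((2 ^ M : ℕ) : ℤ) ↦
      (P : geomPoints (W.baseChange K))) h
    simp only [AddSubgroupClass.coe_zsmul, ZeroMemClass.coe_zero, hy, AddSubgroup.coe_add,
      IsLiftOfAut.coe_torsionMap] at h'
    -- `h' : 2^{M-1} • (R + s • τR) = 0`
    change (((2 : ℕ) : ℤ) ^ (M - 1)) • (R + s • ht.pointsMap W R) = 0 at h'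
    rw [zsmul_add, smul_comm, ← map_zsmul, hR, ← hτt] at h'
    -- `h' : ↑t₁ + s • ↑(τ t₁) = 0` ⟹ `τ t₁ = t₁`
    apply hv
    apply Subtype.ext
    have hneg : -(t₁ : geomPoints (W.baseChange K)) = t₁ := by
      rw [neg_eq_iff_add_eq_zero, ← two_zsmul]
      exact_mod_cast ht₁2
    rcases hs with rfl | rfl
    · rw [one_zsmul] at h'
      rw [eq_neg_of_add_eq_zero_right h', hneg]
    · rw [neg_one_zsmul, ← sub_eq_add_neg, sub_eq_zero] at h'
      exact h'.symm
  -- hence `ord y = 2^M` and `k • y = 0 ⟹ 2^M ∣ k`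
  have hdvd := (zsmul_eq_zero_iff_prime_pow_dvd Nat.prime_two hyM hybot k).mp hk
  rwa [← Nat.cast_pow] at hdvd

end Summit.BirchSwinnertonDyer.BirchSwinnertonDyer.Theorems.KolyvaginPairDataTwo
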